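import Summits.BirchSwinnertonDyer.Rank1Residual.X11b.BDPRouteSelmerCountExact
import Summits.BirchSwinnertonDyer.Rank1Residual.X11b.BDPRouteLocalIndexTorsion
import HarnessLib

/-!
# Crux `AnticycControlAdditive` (route `SchneiderFreeAdditiveX3`, items stmt-BirchSwinnertonDyer-19178 /
# 19295): the TORSION-ROBUST base Selmer count, part 1 — FINITENESS and the bound
# `#Sel_𝔭(K, E[p^∞]) · #E(ℚ_p)[p^∞] ≤ p^a` for EVERY reduction type, without (iv), given `E(K)[p] = 0`

Seat `bsd-schneider-door-c4`, gen 2 (cell `bsd-schneider-ideate`). On the `t_p ≥ 1` half of the crux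
(`E(ℚ_p)[p] ≠ 0`) gen 0's torsion-robust glue `additiveControlOnTreeAt_of_torsAtoms` needs the base count
(P6-add-tors) `#Sel_𝔭(K, E[p^∞]) = p^{a}`, `a = ord_p #Ш + 2(ord_p log_ω P − ord_p[E(K):ℤP]) + ord_p ∏_{w∣p} c_w
+ g − t` with `t = t_p` (companion `…LocalKernelAtP.lean`) and `g = 0` on regime B1 (`E(K)[p] = 0`). The
X11b cell proved exactly this shape — `#Sel_𝔭(K,E[p^∞]) · #E(ℚ_p)[p^∞] = p^a` — at a MULTIPLICATIVE prime
(`X11b.selmerCardBoundTorsion_of_rankOne`, `X11b.natCard_selmerAcBase_mul_eq_of_rankOne`, sub-cell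
multr1-p2 gens 17–19), using multiplicativity ONLY through the local exponent
`exists_addEquiv_valuation_psi_padicPointOf_of_mult` (`e(P) = ord log + ord c_p − 1`) and `Irr` ONLY through
`E(K)[p] = 0`. This file is part 1 of the reduction-type-free, torsion-robust port (the O5 cell did the
same port under (iv), `O5.HeegnerLogTransport.natCard_selmerAcBase_eq_pow_of_noLocalTorsion`):

* **`selmerCardBoundTorsion_of_rankOne_anyReduction`** — for `W/ℚ` globally minimal, ANY prime `p`,
  `K` imaginary quadratic with `p` split, `E(K)[p] = 0`, `rank E(K) = 1`, `Ш(E/K)` finite, `P ∈ E(K)`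
  non-torsion and a degree-one `𝔭 ∣ p`: `Sel_𝔭(K, E[p^∞])` is FINITE and
  `#Sel_𝔭(K,E[p^∞]) · #E(ℚ_p)[p^∞] ≤ p^a`,
  `a ≤ ord_p #Ш[p^∞] + 2((ord_p log_ω P + ord_p #Ẽ_ns(𝔽_p) − 1) − ord_p[E(K):ℤP]) + ord_p ∏_{w∣p} c_w` — the
  X11b proof VERBATIM with the reduction-free exponent `exists_addEquiv_valuation_psi_padicPointOf`
  (`e(P) = ord log + ord c_p + ord #Ẽ_ns(𝔽_p) − 1`) and `E(K)[p] = 0` as a hypothesis (credit: multr1-p2).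

Part 2 (`…BaseCountTorsionExact.lean`) gives the EQUALITY and the additive reading (`#Ẽ_ns(𝔽_p) = p`).
CONDITIONAL on the cited `poitouTate_sum_localTatePairing_eq_zero K` (Milne ADT I 4.10, reciprocity half)
and `localEulerPoincareCharacteristic` (Milne ADT I 2.8); no `Prop` fact minted; closes nothing by itself;
BSD is not proved by any of this.

References: [JetchevSkinnerWan2017] Prop. 3.2.1 (proof, arXiv:1512.06894 pp. 10–11), (7.1.5) (p. 16);
[Castella2018] proof of Thm. 2.3, (3.2.1)+(calcul) (arXiv:1704.06608 pp. 5–6); [MilneADT2006] I 4.10, 2.8;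
[GreenbergLNM1716] §3.
-/

noncomputable section

open scoped Classical

open WeierstrassCurve NumberField IsDedekindDomain Field
open Literature.NumberTheory.EllipticCurves Literature.NumberTheory.EllipticCurves.GreenbergSelmer
  Literature.NumberTheory.EllipticCurves.Rank1Residual
  Literature.NumberTheory.EllipticCurves.Rank1Residual.Typed
  Literature.NumberTheory.GaloisRepresentations Literature.NumberTheory.GaloisCohomology
  Summit.BirchSwinnertonDyer.Rank1Residual
  Summit.BirchSwinnertonDyer.Rank1Residual.X11b
  Summit.BirchSwinnertonDyer.Rank1Residual.X11b.AcSelmer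
  Summit.BirchSwinnertonDyer.Rank1Residual.X11b.LocBridge

set_option linter.dupNamespace false

namespace Summit.BirchSwinnertonDyer.BirchSwinnertonDyer.Theorems.SchneiderFreeAdditiveX3

/-- **The Selmer bound `#Sel_𝔭(K,E[p^∞]) · #E(ℚ_p)[p^∞] ≤ p^a` (hence FINITENESS of Castella's Selmer group
over `K`) at a RANK-ONE datum, ANY prime `p` and ANY reduction type, given `E(K)[p] = 0`**: `K` imaginary
quadratic with `p` split, `rank E(K) = 1`, `Ш(E/K)` finite, `P ∈ E(K)` non-torsion, `𝔭 ∣ p` of degree one;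
`a ≤ ord_p #Ш[p^∞] + 2((ord_p log_ω P + ord_p #Ẽ_ns(𝔽_p) − 1) − ord_p[E(K):ℤP]) + ord_p ∏_{w∣p} c_w`. The
X11b theorem `selmerCardBoundTorsion_of_rankOne` (JSW17 Prop. 3.2.1 `≤` at every level `p^k`, passage to the
limit) with the reduction-type-free local exponent. CONDITIONAL on the two named facts.
[cite: JetchevSkinnerWan2017, Prop. 3.2.1 (proof, arXiv:1512.06894 pp. 10–11)]
[cite: Castella2018, proof of Thm. 2.3, (3.2.1) and (calcul) (arXiv:1704.06608 pp. 5–6)]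
[cite: MilneADT2006, Ch. I, Thm. 4.10(b) and Thm. 2.8] -/
theorem selmerCardBoundTorsion_of_rankOne_anyReduction (W : WeierstrassCurve ℚ) [W.IsElliptic]
    [W.IsGloballyMinimal] (p : ℕ) [Fact p.Prime] (K : Type) [Field K] [NumberField K]
    (hPT : poitouTate_sum_localTatePairing_eq_zero K)
    (hEP : ∀ v : HeightOneSpectrum (𝓞 K), localEulerPoincareCharacteristic (v.adicCompletion K))
    (hK : IsImaginaryQuadratic K) (hsplit : SplitsIn K p)
    (hivK : ∀ x : (W.baseChange K).toAffine.Point, p • x = 0 → x = 0)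
    (hrank : (W.baseChange K).mordellWeilRank = 1) (hSha : (W.baseChange K).ShaFinite)
    (P : (W.baseChange K).toAffine.Point) (hPinf : ¬ IsOfFinAddOrder P)
    (𝔭 : HeightOneSpectrum (𝓞 K)) (h𝔭 : ((p : ℕ) : 𝓞 K) ∈ 𝔭.asIdeal)
    (he : 𝔭.asIdeal.ramificationIdx (𝓞 ℚ) = 1) (hf : 𝔭.asIdeal.inertiaDeg (𝓞 ℚ) = 1) :
    ∃ (_ : Finite (selmerAcBase (W.baseChange K) p 𝔭 ∅)) (a : ℕ),
      Nat.card (selmerAcBase (W.baseChange K) p 𝔭 ∅) *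
          Nat.card (AddCommGroup.primaryComponent (W.baseChange ℚ_[p]).toAffine.Point p) ≤
        p ^ a ∧
      (a : ℤ) ≤
        (padicValNat p (Nat.card (AddCommGroup.primaryComponent (W.baseChange K).sha p)) : ℤ) +
        2 * ((X11b.padicLogOrd W p (embAt K p 𝔭 h𝔭 he hf) P + padicValNat p (reductionPointCount W p) - 1) -
          (padicValNat p (AddSubgroup.zmultiples P).index : ℤ)) +
          padicValNat p (tamagawaProductAbove W K p) := by
  revert P
  set E := W.baseChange K with hEdef
  set G := W.baseChange ℚ_[p] with hGdef
  intro P hPinf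
  haveI hEK : E.IsElliptic := by rw [hEdef, baseChange]; infer_instance
  have h2 : Module.finrank ℚ K = 2 := hK.1
  have hp : p.Prime := Fact.out
  -- Kolyvagin: `rank E(K) = 1`, `Ш(E/K)` finite
  haveI hShaFin : Finite E.sha := hSha
  set ιp := embAt K p 𝔭 h𝔭 he hf with hιp
  set f : E.toAffine.Point →+ G.toAffine.Point := Affine.Point.map (W' := W) ιp.toRatAlgHom with hfdef
  have hfapply : ∀ x, f x = X11b.padicPointOf W p ιp x := fun _ => rfl
  have hfinj : Function.Injective f := Affine.Point.map_injective (W' := W) ιp.toRatAlgHom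
  -- a coordinate `c : E(K) → ℤ` and a generator `Q`
  obtain ⟨c, Q, hcQ, hcker⟩ := RankOne.exists_coord_of_mordellWeilRank_eq_one E hrank
  have hA : ∀ a : E.toAffine.Point, IsOfFinAddOrder (a - c a • Q) :=
    RankOne.isOfFinAddOrder_sub_coord_zsmul c Q hcQ hcker
  have hQinf : ¬ IsOfFinAddOrder Q := fun hQ => by
    have h := RankOne.coord_eq_zero_of_isOfFinAddOrder c hQ
    rw [hcQ] at h
    exact one_ne_zero h
  have hxinf : ¬ IsOfFinAddOrder (f Q) := fun hx => hQinf ((hfinj.isOfFinAddOrder_iff).mp hx)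
  have hyinf : ¬ IsOfFinAddOrder (f P) := fun hy => hPinf ((hfinj.isOfFinAddOrder_iff).mp hy)
  have hcP : c P ≠ 0 := fun h0 => hPinf (hcker P h0)
  -- the `ℤ_p`-coordinate `Ψ` on `E(ℚ_p)`: `Ψ(E(ℚ_p)) = p^m ℤ_p`, `p^m = #E(ℚ_p)[p^∞]`
  haveI hfi2 : (G.formalFiltration 2).FiniteIndex := G.finiteIndex_formalFiltration 2
  set cp := padicValNat p (G.localTamagawaNumber ℤ_[p]) with hcpdef
  set ns := padicValNat p (reductionPointCount W p) with hnsdef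
  obtain ⟨φ, hφ⟩ := LocalIndex.exists_addEquiv_valuation_psi_padicPointOf W p (K := K)
  obtain ⟨m, hmrange, hmcard, hmle⟩ :=
    LocalIndex.exists_pow_eq_card_and_le_valuation_psi (G.formalFiltration 2) φ
  set Ψ := LocalIndex.psi (G.formalFiltration 2) φ with hΨ
  set eQ := (Ψ (f Q)).valuation with heQdef
  set eP := (Ψ (f P)).valuation with hePdef
  have hΨQ : Ψ (f Q) ≠ 0 := fun h0 => hxinf ((LocalIndex.psi_eq_zero_iff _ φ _).mp h0)
  have hmeQ : m ≤ eQ := hmle (f Q) hΨQ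
  -- the exponents: `e(P) = padicLogOrd P + c_p − 1`, `e(P) = ord_p c(P) + e(Q)`
  have heP : (eP : ℤ) = X11b.padicLogOrd W p ιp P + cp + ns - 1 := hφ ιp P hyinf
  have hyx : f P = c P • f Q + f (P - c P • Q) := by rw [map_sub, map_zsmul]; abel
  have hePQ : eP = padicValNat p (c P).natAbs + eQ := by
    rw [hePdef, hyx]
    exact LocalIndex.valuation_psi_zsmul_add (G.formalFiltration 2) φ hxinf
      (f.isOfFinAddOrder (hA P)) hcP
  -- `ord_p [E(K) : ℤP] = ord_p |c(P)|`
  haveI : Finite (AddCommGroup.torsion E.toAffine.Point) := E.finite_torsion_point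
  have hI : padicValNat p (AddSubgroup.zmultiples P).index = padicValNat p (c P).natAbs :=
    RankOne.padicValNat_index_zmultiples_eq c Q hcQ hcker hivK P hcP
  -- (v) `ord_p ∏_{w∣p} c_w = 2 ord_p c_p`
  have htam : padicValNat p (tamagawaProductAbove W K p) = 2 * cp :=
    LocalIndexTransport.padicValNat_tamagawaProductAbove_eq_two_mul W K p h2 hsplit
  -- the two primes above `p`
  obtain ⟨σ, 𝔮, hσ, -, -, hall⟩ := LocalIndexTransport.exists_conj_prime_of_splitsIn K p h2 hsplit h𝔭
  have h𝔮 : ∀ v : HeightOneSpectrum (𝓞 K), v ≠ 𝔭 → ((p : ℕ) : 𝓞 K) ∈ v.asIdeal → v = 𝔮 :=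
    fun v hv hpv => (hall v hpv).resolve_left hv
  -- `Ш[p^k] ⊆ Ш[p^∞]`, `#Ш[p^∞] = p^v`
  set S := Nat.card (AddCommGroup.primaryComponent E.sha p) with hSdef
  obtain ⟨v, hv⟩ : ∃ v : ℕ, S = p ^ v := X11b.exists_natCard_primaryComponent_eq_pow p
  -- THE LEVEL BOUNDS
  set B : ℕ := (p ^ (eQ - m) * p ^ m) * (S * p ^ (eQ - m)) with hBdef
  have hlevel : ∀ k, Finite (acLevelStructure E p k 𝔭 ∅).selmerGroup ∧
      Nat.card (acLevelStructure E p k 𝔭 ∅).selmerGroup ≤ B := by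
    intro k
    rcases Nat.eq_zero_or_pos k with rfl | hk
    · obtain ⟨hfin, hle⟩ := finite_and_natCard_selmerGroup_acLevelStructure_zero E p 𝔭 ∅
      refine ⟨hfin, hle.trans ?_⟩
      have hS1 : 1 ≤ S := by rw [hv]; exact Nat.one_le_pow _ _ hp.pos
      calc 1 ≤ S := hS1
        _ ≤ S * p ^ (eQ - m) := Nat.le_mul_of_pos_right _ (pow_pos hp.pos _)
        _ ≤ (p ^ (eQ - m) * p ^ m) * (S * p ^ (eQ - m)) :=
            Nat.le_mul_of_pos_left _ (Nat.mul_pos (pow_pos hp.pos _) (pow_pos hp.pos _))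
    · -- the indices at level `k`, read in `E(ℚ_p)` through `Ψ`
      have hL₁ : ((Affine.Point.baseChange (W' := W.baseChange K) K (𝔭.adicCompletion K)).range ⊔
          (zsmulAddGroupHom ((p ^ k : ℕ) : ℤ) :
            ((W.baseChange K).baseChange (𝔭.adicCompletion K)).toAffine.Point →+ _).range).index ≤
          p ^ min k (eQ - m) * p ^ m := by
        rw [LocalIndexTransport.index_range_baseChange_sup_eq_padic K p 𝔭 h𝔭 he hf W,
          RankOne.range_zsmulAddGroupHom_natCast, sup_comm]
        change ((nsmulAddMonoidHom (p ^ k) : G.toAffine.Point →+ _).range ⊔ f.range).index ≤ _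
        rw [LocalIndex.range_nsmul_sup_range_eq_of_source f c Q hA k hivK, hmcard]
        exact LocalIndex.index_range_nsmul_sup_zmultiples_le (G.formalFiltration 2) φ hmrange
          (f Q) hxinf k
      have hM : (AddCommGroup.torsion ((W.baseChange K).baseChange (𝔭.adicCompletion K)).toAffine.Point ⊔
          (zsmulAddGroupHom ((p ^ k : ℕ) : ℤ) :
            ((W.baseChange K).baseChange (𝔭.adicCompletion K)).toAffine.Point →+ _).range).index =
          p ^ k := by
        rw [index_torsion_sup_range_zsmul_eq_padic K p 𝔭 h𝔭 he hf W,
          RankOne.range_zsmulAddGroupHom_natCast]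
        exact LocalIndex.index_torsion_sup_range_nsmul (G.formalFiltration 2) φ k
      have hN : ((zsmulAddGroupHom ((p ^ k : ℕ) : ℤ) : E.toAffine.Point →+ _).range).index =
          p ^ k := RankOne.index_range_zsmul_pow_eq c Q hcQ hcker hivK k
      have hL₂ : ((Affine.Point.baseChange (W' := W.baseChange K) K (𝔭.adicCompletion K)).range ⊔
          (AddCommGroup.torsion ((W.baseChange K).baseChange (𝔭.adicCompletion K)).toAffine.Point ⊔
            (zsmulAddGroupHom ((p ^ k : ℕ) : ℤ) :
              ((W.baseChange K).baseChange (𝔭.adicCompletion K)).toAffine.Point →+ _).range)).index =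
          p ^ min k (eQ - m) := by
        rw [index_range_baseChange_sup_torsion_sup_eq_padic K p 𝔭 h𝔭 he hf W,
          RankOne.range_zsmulAddGroupHom_natCast]
        change (f.range ⊔ (AddCommGroup.torsion G.toAffine.Point ⊔
          (nsmulAddMonoidHom (p ^ k) : G.toAffine.Point →+ _).range)).index = _
        have hrw : f.range ⊔ (AddCommGroup.torsion G.toAffine.Point ⊔
            (nsmulAddMonoidHom (p ^ k) : G.toAffine.Point →+ _).range) =
            AddCommGroup.torsion G.toAffine.Point ⊔
              ((nsmulAddMonoidHom (p ^ k) : G.toAffine.Point →+ _).range ⊔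
                AddSubgroup.zmultiples (f Q)) := by
          rw [← LocalIndex.range_nsmul_sup_range_eq_of_source f c Q hA k hivK]
          ac_rfl
        rw [hrw]
        exact LocalIndex.index_torsion_sup_range_nsmul_sup_zmultiples (G.formalFiltration 2) φ
          hmrange (f Q) hxinf k
      obtain ⟨hfin, hle⟩ := SelmerLevelBound.natCard_level_le_of_indices_torsion W K p k 𝔭 𝔮 hk
        σ hσ h𝔮 hPT (hEP 𝔮) rfl hM (pow_ne_zero _ hp.ne_zero) hN hL₂
        (natCard_sha_inf_torsionBy_le E p k)
      refine ⟨hfin, hle.trans ?_⟩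
      have hmin : p ^ min k (eQ - m) ≤ p ^ (eQ - m) := Nat.pow_le_pow_right hp.pos (min_le_right _ _)
      exact Nat.mul_le_mul (hL₁.trans (Nat.mul_le_mul_right _ hmin))
        (Nat.mul_le_mul_left _ hmin)
  -- pass to the limit
  obtain ⟨hfinSel, hcard⟩ := LevelKummer.exists_finite_selmerAcBase_natCard_le E p 𝔭 ∅
    E.zsmul_geomPoints_surjective_holds B (fun k => (hlevel k).1) (fun k => (hlevel k).2)
  refine ⟨hfinSel, v + 2 * eQ, ?_, ?_⟩
  · rw [← hmcard]
    calc Nat.card (selmerAcBase E p 𝔭 ∅) * p ^ m ≤ B * p ^ m := Nat.mul_le_mul_right _ hcard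
      _ = p ^ (v + 2 * eQ) := by
          rw [hBdef, hv, ← pow_add, ← pow_add, ← pow_add, ← pow_add]
          congr 1
          omega
  · have hvS : padicValNat p S = v := by rw [hv, padicValNat.prime_pow]
    rw [hvS, hI, htam]
    have hePQZ : (eP : ℤ) = (padicValNat p (c P).natAbs : ℤ) + (eQ : ℤ) := by exact_mod_cast hePQ
    have hcast : (((v + 2 * eQ : ℕ) : ℤ)) = (v : ℤ) + 2 * (eQ : ℤ) := by push_cast; ring
    have hcast2 : (((2 * cp : ℕ) : ℤ)) = 2 * (cp : ℤ) := by push_cast; ring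
    rw [hcast, hcast2]
    linarith [hePQZ, heP]

end Summit.BirchSwinnertonDyer.BirchSwinnertonDyer.Theorems.SchneiderFreeAdditiveX3

end
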